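import Summits.NavierStokesRegularity.TurbBounds.Certs.N1prime.EvalGrams
import Summits.NavierStokesRegularity.TurbBounds.IntervalLemma
import Summits.NavierStokesRegularity.TurbBounds.IntervalLemmaR
import Summits.NavierStokesRegularity.TurbBounds.Certs.N1prime.EvalBlock04
import Summits.NavierStokesRegularity.TurbBounds.Certs.N1prime.EvalBlock05
import HarnessLib

/-!
# Row N1prime evaluator — COVER part 3/30: interval 3 = [1/2, 1] (tangent), blocks 4, 5
(cell `pub-turb` / `turb-bounds`, v2 item RB-N1′-in-Lean per HOME/pub-turb-cert/RB-LEAN-V2-DESIGN.md §1; producer of THIS FILE pub-turb-cert = prover-pub-turb-cert-g7-0 (t12_evaluator_rb.py, the P > 0 extension of pub-turb-sos's t12_evaluator.py); row and source container by pub-turb-cert: `HOME/pub-turb-cert/certs/N1prime-canary-ra1e4-allk/rbcert.json`, rbcert/0, sha256 `5daad8d71401bf8a…`; CERTIFIED.md row RB-N1′: Ra = 10000, ALL horizontal periods / lattices, `Nu ≤ 871753553815459157/273640575184404480` (outward decimal 3.1857613).)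

HONEST FRAMING: rigorous bounds for the stated PDE and boundary conditions; no claim about physical turbulence beyond the bound.
FILE LAYOUT of the row-N1prime evaluator (one namespace `Summit.NavierStokesRegularity.TurbBounds.Certs.N1prime.Evaluator` reopened across the files, every file ≤ 400 lines; the layout of the tree's `Certs/N0` (lemma R-I′ rows) and `Certs/P2R4` (per-interval COVER files) evaluators): `EvalData1…7.lean` (§1–2: constants and the 14 piece matrices — DATA) → `EvalRule.lean` (§3: the rule `Mel`, its pencil forms, the real pencil `MelR` and the block-to-pencil transfer) → `EvalGramB.lean` + `EvalGrams.lean` (§4: `Bcoef ⪰ 0` by a streaming integer Gram certificate, `Acoef ⪰ 0` diagonal, `TT ⪰ 0` Gram) → `EvalBlock01…59.lean` (§5: one file per block, the evaluator identity `eval_j : B0jj.A = den_j • Mel ε_j u_j v_j` against the landed block module, via the LIST identity `B0jj.A_rows = EvalRows.lincomb (psOf …)` — `TurbBounds/EvalRows.lean`) → `Cover01…Cover30.lean` (§6: per cover interval, the interval theorem `interval_i`) → `Evaluator.lean` (§8: **`certificate`**; `cutoff` is in EvalData1 — the full statement of what is and is NOT kernel-checked is in THAT file's header); generic interval lemmas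 in `TurbBounds/IntervalLemma.lean` + `IntervalLemmaR.lean` (in the tree).
-/

set_option linter.style.longLine false
set_option linter.style.setOption false
set_option linter.unusedSimpArgs false
set_option maxRecDepth 100000

namespace Summit.NavierStokesRegularity.TurbBounds.Certs.N1prime.Evaluator

open Literature.Computation.Certificates Matrix

/-! ## 6. Interval theorem 3 -/

/-- **Interval 3** `[1/2, 1]` (tangent pair: blocks 4 (`ε4`, tan-left), 5 (`ε5`, tan-right); `Kt = 1`; lemma R-I′): for every real `K` in it there is a Young
weight `ε > 0` at which the rule is PSD at `(1/K, K)` with both tail scalars `≥ 0`. -/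
theorem interval_3 : ∀ K : ℝ, ((1 : ℝ) / 2) ≤ K → K ≤ (1 : ℝ) → ∃ ε : ℝ, 0 < ε ∧ (MelR ε (1 / K) K : Matrix (Fin 62) (Fin 62) ℝ).PosSemidef ∧
      0 ≤ 16 * (1 / K) * (a0 : ℝ) - (T : ℝ) * ε * (lamW : ℝ) ∧ 0 ≤ 4 * (s : ℝ) - (T : ℝ) * (lamT : ℝ) / ε := by
  have h1 := MelR_posSemidef_of_eval den4_pos eval4 B004.posSemidef (ε' := (ε4 : ℝ))
    (u' := (2 * (1 : ℝ) - ((1 : ℝ) / 2)) / (1 : ℝ) ^ 2) (v' := ((1 : ℝ) / 2)) rfl (by norm_num [u4]) (by norm_num [v4])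
  have h2 := MelR_posSemidef_of_eval den5_pos eval5 B005.posSemidef (ε' := (ε5 : ℝ))
    (u' := 1 / (1 : ℝ)) (v' := (1 : ℝ)) rfl (by norm_num [u5]) (by norm_num [v5])
  rw [MelR_eq5] at h1 h2
  intro K hK hK'
  obtain ⟨ε, hε, hP, hW, hT⟩ := pencil_on_interval_tangent_mixed (Mb.map (Rat.cast : ℚ → ℝ)) (Acoef.map (Rat.cast : ℚ → ℝ))
    (Bcoef.map (Rat.cast : ℚ → ℝ)) (TW.map (Rat.cast : ℚ → ℝ)) (TT.map (Rat.cast : ℚ → ℝ)) Acoef_posSemidef TT_posSemidef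
    (T := (T : ℝ)) (a := (a0 : ℝ)) (s := (s : ℝ)) (lW := (lamW : ℝ)) (lT := (lamT : ℝ))
    (by norm_num [T]) (by norm_num [a0, s, Ra]) (by norm_num [T, lamT])
    (by norm_num : (0 : ℝ) < ((1 : ℝ) / 2)) (by norm_num : (((1 : ℝ) / 2) : ℝ) ≤ (1 : ℝ)) (by norm_num [ε4] : (0 : ℝ) < (ε4 : ℝ)) (by norm_num [ε5] : (0 : ℝ) < (ε5 : ℝ))
    h1 h2 (by norm_num [a0, s, Ra, T, ε4, lamW]) (by norm_num [a0, s, Ra, T, ε5, lamW]) (by norm_num [a0, s, Ra, T, ε4, lamT]) (by norm_num [a0, s, Ra, T, ε5, lamT])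
    K hK hK'
  exact ⟨ε, hε, by rw [MelR_eq5]; exact hP, hW, hT⟩

end Summit.NavierStokesRegularity.TurbBounds.Certs.N1prime.Evaluator
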